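import Mathlib.RingTheory.Polynomial.Chebyshev
import Mathlib.Analysis.SpecialFunctions.Trigonometric.Chebyshev.Basic
import Mathlib.Analysis.SpecialFunctions.Trigonometric.Inverse
import Mathlib.Analysis.Calculus.IteratedDeriv.Lemmas
import Mathlib.Algebra.Polynomial.Derivative
import Mathlib.Algebra.Polynomial.Eval.SMul
import Mathlib.Analysis.Calculus.Deriv.Polynomial
import HarnessLib

/-!
# Derivative bounds for Chebyshev polynomials and nonnegative Chebyshev combinations

Topic `Literature/Analysis/Fourier`.  The classical bounds of V. A. Markov / Bernstein type for the
Chebyshev polynomials on `[-1, 1]`,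

  `|T_n^{(i)}(x)| ≤ n^{2i}`,  `|U_{n-1}^{(i)}(x)| ≤ n^{2i+1}`  (`n ≥ 1`, `|x| ≤ 1`),

proved by the elementary induction `T_n' = n U_{n-1}`, `U_{n-1} = U_{n-3} + 2 T_{n-1}` (so that all
derivatives of `T_n` are NONNEGATIVE combinations of lower Chebyshev polynomials and are maximised at
`x = 1`; this is the weak form `‖P_n^{(k)}‖ ≤ n^{2k}‖P_n‖` of V. A. Markov's inequality
[KalmykovNagyTotik2021, §6 (20)–(21)] for `P_n = T_n`, `U_{n-1} = T_n'/n`; the sharp value is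
`T_n^{(i)}(1) = Π_{k<i}(n² − k²)/(2k+1)`), and the consequence used for finite-range
decompositions: a nonnegative combination `P = Σ_k w_k T_{n_k}` with `|n_k| ≤ D` satisfies
`|P^{(i)}(x)| ≤ D^{2i} Σ_k w_k` on `[-1,1]` (`abs_iterate_derivative_chebComb_le`) — the "bulk" bound
`λ^ℓ |∂_λ^ℓ W_t(λ)| ≲ 1` for `λ t² ≲ 1` of Bauerschmidt's polynomials [Bauerschmidt2013, Lemma 2.3],
[Buchholz2016, Lemma 5.1 (5.3)].  Also: `iteratedDeriv i (fun x => P.eval x) = (derivative^[i] P).eval`.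

Everything is proved; no named facts.

## References
* S. Kalmykov, B. Nagy, V. Totik, *Bernstein- and Markov-type inequalities*, arXiv:2104.02348 (2021), §6
  (V. A. Markov's inequality for higher derivatives, (20)–(21)) [KalmykovNagyTotik2021].
* T. J. Rivlin, *The Chebyshev Polynomials*, Wiley 1974, Ch. 1 (`T_n(cos θ) = cos nθ`, the polynomials
  of the second kind) [Rivlin1974].
* R. Bauerschmidt, Probab. Theory Relat. Fields 157 (2013), Lemma 2.3 [Bauerschmidt2013].
* S. Buchholz, J. Funct. Anal. 275 (2018), Lemma 5.1 [Buchholz2016].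
-/

noncomputable section

open Polynomial Finset

namespace Literature.Analysis.Fourier

open Polynomial.Chebyshev

/-! ## Chebyshev identities -/

/-- `U_n = U_{n-2} + 2 T_n` (all `n ∈ ℤ`). [folklore] -/
private theorem chebyshev_U_eq_U_sub_two_add (n : ℤ) : U ℝ n = U ℝ (n - 2) + 2 * T ℝ n := by
  have h1 := U_add_two ℝ (n - 2)
  have h2 := T_eq_U_sub_X_mul_U ℝ n
  rw [show n - 2 + 2 = n by ring, show n - 2 + 1 = n - 1 by ring] at h1
  linear_combination -h1 - 2 * h2

/-- `|T_n(x)| ≤ 1` for `|x| ≤ 1` (`T_n(cos θ) = cos nθ`). [cite: Rivlin1974, Ch. 1 §1.1] -/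
theorem abs_eval_T_le_one (n : ℤ) {x : ℝ} (hx : x ∈ Set.Icc (-1 : ℝ) 1) : |(T ℝ n).eval x| ≤ 1 := by
  rw [Set.mem_Icc] at hx
  rw [← Real.cos_arccos hx.1 hx.2, T_real_cos]
  exact Real.abs_cos_le_one _

/-! ## The Markov-type bounds -/

/-- The joint bound `|T_n^{(i)}| ≤ n^{2i}` and `|U_{n-1}^{(i)}| ≤ n^{2i+1}` on `[-1,1]`, `n ≥ 1`, by the
induction `T_n' = n U_{n-1}`, `U_{n-1} = U_{n-3} + 2T_{n-1}` (weak V. A. Markov inequality for `T_n` and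
`T_n'/n`). [cite: KalmykovNagyTotik2021, §6 (20)–(21)] -/
theorem abs_iterate_derivative_T_U_le :
    ∀ (n : ℕ), 1 ≤ n → ∀ (i : ℕ) (x : ℝ), x ∈ Set.Icc (-1 : ℝ) 1 →
      |(derivative^[i] (T ℝ n)).eval x| ≤ (n : ℝ) ^ (2 * i) ∧
        |(derivative^[i] (U ℝ ((n : ℤ) - 1))).eval x| ≤ (n : ℝ) ^ (2 * i + 1)
  | 0, h, _, _, _ => absurd h (by norm_num)
  | 1, _, i, x, hx => by
    rw [show ((1 : ℕ) : ℤ) = 1 by rfl, show (1 : ℤ) - 1 = 0 by ring, T_one, U_zero]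
    rcases i with _ | _ | i
    · simp only [Function.iterate_zero, id_eq, eval_X, eval_one, Nat.cast_one, one_pow, abs_one]
      rw [Set.mem_Icc] at hx
      exact ⟨abs_le.2 ⟨hx.1, hx.2⟩, le_rfl⟩
    · simp
    · simp [Function.iterate_succ_apply, iterate_map_zero]
  | n + 2, _, i, x, hx => by
    -- induction hypotheses for `n + 1` (for `T_{n+1}`) and for `n` (for `U_{n-1}`)
    have ihT : ∀ i, |(derivative^[i] (T ℝ ((n : ℤ) + 1))).eval x| ≤ ((n : ℝ) + 1) ^ (2 * i) := by
      intro i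
      have h := (abs_iterate_derivative_T_U_le (n + 1) (by omega) i x hx).1
      push_cast at h
      exact h
    have ihU : ∀ i, |(derivative^[i] (U ℝ ((n : ℤ) - 1))).eval x| ≤ (n : ℝ) ^ (2 * i + 1) := by
      intro i
      rcases Nat.eq_zero_or_pos n with h0 | hpos
      · subst h0
        simp [U_neg_one, iterate_map_zero]
      · exact (abs_iterate_derivative_T_U_le n hpos i x hx).2
    -- the `U` bound for `n + 2`: `U_{n+1} = U_{n-1} + 2 T_{n+1}`
    have hU : ∀ i, |(derivative^[i] (U ℝ (((n + 2 : ℕ) : ℤ) - 1))).eval x| ≤ ((n : ℝ) + 2) ^ (2 * i + 1) := by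
      intro i
      have hid : U ℝ (((n + 2 : ℕ) : ℤ) - 1) = U ℝ ((n : ℤ) - 1) + (2 : ℝ) • T ℝ ((n : ℤ) + 1) := by
        rw [show (((n + 2 : ℕ) : ℤ) - 1) = (n : ℤ) + 1 by push_cast; ring, chebyshev_U_eq_U_sub_two_add,
          show (n : ℤ) + 1 - 2 = (n : ℤ) - 1 by ring, two_mul, two_smul]
      rw [hid, iterate_map_add, iterate_derivative_smul, eval_add, eval_smul, smul_eq_mul]
      refine (abs_add_le _ _).trans ?_
      rw [abs_mul, abs_two]
      have h1 := ihU i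
      have h2 := ihT i
      -- `n^{2i+1} + 2 (n+1)^{2i} ≤ (n+2)^{2i+1}`
      have hn : (0 : ℝ) ≤ n := Nat.cast_nonneg n
      have e1 : (n : ℝ) ^ (2 * i + 1) ≤ (n : ℝ) * ((n : ℝ) + 2) ^ (2 * i) := by
        rw [pow_succ, mul_comm]
        exact mul_le_mul_of_nonneg_left (pow_le_pow_left₀ hn (by linarith) _) hn
      have e2 : ((n : ℝ) + 1) ^ (2 * i) ≤ ((n : ℝ) + 2) ^ (2 * i) :=
        pow_le_pow_left₀ (by linarith) (by linarith) _
      calc |eval x ((derivative^[i]) (U ℝ ((n : ℤ) - 1)))| + 2 * |eval x ((derivative^[i]) (T ℝ ((n : ℤ) + 1)))|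
          ≤ (n : ℝ) * ((n : ℝ) + 2) ^ (2 * i) + 2 * ((n : ℝ) + 2) ^ (2 * i) := by linarith
        _ = ((n : ℝ) + 2) ^ (2 * i + 1) := by ring
    refine ⟨?_, by exact_mod_cast hU i⟩
    -- the `T` bound for `n + 2`: `T' = (n+2) U_{n+1}`
    rcases i with _ | i
    · simp only [Function.iterate_zero, id_eq, Nat.mul_zero, pow_zero]
      exact abs_eval_T_le_one _ hx
    · rw [Function.iterate_succ_apply, T_derivative_eq_U, iterate_derivative_intCast_mul, eval_mul, eval_intCast,
        abs_mul]
      push_cast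
      rw [abs_of_nonneg (by positivity : (0 : ℝ) ≤ (n : ℝ) + 2)]
      calc ((n : ℝ) + 2) * |eval x ((derivative^[i]) (U ℝ ((n : ℤ) + 2 - 1)))|
          ≤ ((n : ℝ) + 2) * ((n : ℝ) + 2) ^ (2 * i + 1) := by
            refine mul_le_mul_of_nonneg_left ?_ (by positivity)
            have := hU i
            push_cast at this
            exact this
        _ = ((n : ℝ) + 2) ^ (2 * (i + 1)) := by ring

/-- **Markov-type bound for `T_n`**: `|T_n^{(i)}(x)| ≤ |n|^{2i}` on `[-1,1]`, all `n ∈ ℤ` (V. A. Markov's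
inequality `‖P_n^{(k)}‖ ≤ n^{2k} ‖P_n‖` for `P_n = T_n`). [cite: KalmykovNagyTotik2021, §6 (21)] -/
theorem abs_iterate_derivative_T_le (n : ℤ) (i : ℕ) {x : ℝ} (hx : x ∈ Set.Icc (-1 : ℝ) 1) :
    |(derivative^[i] (T ℝ n)).eval x| ≤ (|n| : ℝ) ^ (2 * i) := by
  -- reduce to `n ≥ 0` by `T_{-n} = T_n`, then to `n ≥ 1`
  suffices h : ∀ m : ℕ, |(derivative^[i] (T ℝ m)).eval x| ≤ (m : ℝ) ^ (2 * i) by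
    rcases Int.natAbs_eq n with hn | hn
    · rw [hn, Int.cast_natCast, Nat.abs_cast]; exact h _
    · rw [hn, T_neg, Int.cast_neg, Int.cast_natCast, abs_neg, Nat.abs_cast]; exact h _
  intro m
  rcases Nat.eq_zero_or_pos m with h0 | hpos
  · subst h0
    rcases i with _ | i
    · simp [T_zero]
    · simp [T_zero, Function.iterate_succ_apply]
  · exact (abs_iterate_derivative_T_U_le m hpos i x hx).1

/-! ## Nonnegative Chebyshev combinations -/

/-- **Bulk derivative bound for nonnegative Chebyshev combinations**: if `w_k ≥ 0` and `|n_k| ≤ D` then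
`P = Σ_k w_k T_{n_k}` satisfies `|P^{(i)}(x)| ≤ D^{2i} Σ_k w_k` on `[-1,1]` (the `λt² ≲ 1` regime of the
symbol estimate for `W_t = Σ φ̂(ν/t) T_ν`). [cite: Buchholz2016, Lemma 5.1 (5.3)] -/
theorem abs_iterate_derivative_chebComb_le {ι : Type*} (S : Finset ι) (w : ι → ℝ) (nk : ι → ℤ) (D : ℕ)
    (hw : ∀ k ∈ S, 0 ≤ w k) (hn : ∀ k ∈ S, |nk k| ≤ D) (i : ℕ) {x : ℝ} (hx : x ∈ Set.Icc (-1 : ℝ) 1) :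
    |(derivative^[i] (∑ k ∈ S, w k • T ℝ (nk k))).eval x| ≤ (D : ℝ) ^ (2 * i) * ∑ k ∈ S, w k := by
  rw [iterate_derivative_sum, eval_finsetSum, mul_sum]
  refine (abs_sum_le_sum_abs _ _).trans (sum_le_sum fun k hk => ?_)
  rw [iterate_derivative_smul, eval_smul, smul_eq_mul, abs_mul, abs_of_nonneg (hw k hk), mul_comm]
  refine mul_le_mul_of_nonneg_right ?_ (hw k hk)
  refine (abs_iterate_derivative_T_le (nk k) i hx).trans ?_
  have : (|nk k| : ℝ) ≤ D := by exact_mod_cast hn k hk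
  exact pow_le_pow_left₀ (by positivity) this _

/-- Iterated derivatives of a polynomial function are the evaluations of the iterated formal derivatives.
[folklore] -/
private theorem iteratedDeriv_polynomial_eval (P : ℝ[X]) :
    ∀ i : ℕ, iteratedDeriv i (fun x => P.eval x) = fun x => (derivative^[i] P).eval x
  | 0 => by simp
  | i + 1 => by
    rw [iteratedDeriv_succ, iteratedDeriv_polynomial_eval P i, Function.iterate_succ_apply']
    funext x
    exact Polynomial.deriv _

/-- The bulk bound in analytic form: `|(d/dx)^i (Σ_k w_k T_{n_k})(x)| ≤ D^{2i} Σ_k w_k` on `[-1,1]`.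
[cite: Buchholz2016, Lemma 5.1 (5.3)] -/
theorem abs_iteratedDeriv_chebComb_le {ι : Type*} (S : Finset ι) (w : ι → ℝ) (nk : ι → ℤ) (D : ℕ)
    (hw : ∀ k ∈ S, 0 ≤ w k) (hn : ∀ k ∈ S, |nk k| ≤ D) (i : ℕ) {x : ℝ} (hx : x ∈ Set.Icc (-1 : ℝ) 1) :
    |iteratedDeriv i (fun y => (∑ k ∈ S, w k • T ℝ (nk k)).eval y) x| ≤ (D : ℝ) ^ (2 * i) * ∑ k ∈ S, w k := by
  rw [iteratedDeriv_polynomial_eval]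
  exact abs_iterate_derivative_chebComb_le S w nk D hw hn i hx

/-- Evaluation of a Chebyshev combination at `cos θ`: `(Σ_k w_k T_{n_k})(cos θ) = Σ_k w_k cos(n_k θ)`.
[cite: Rivlin1974, Ch. 1 §1.1] -/
theorem eval_chebComb_cos {ι : Type*} (S : Finset ι) (w : ι → ℝ) (nk : ι → ℤ) (θ : ℝ) :
    (∑ k ∈ S, w k • T ℝ (nk k)).eval (Real.cos θ) = ∑ k ∈ S, w k * Real.cos (nk k * θ) := by
  rw [eval_finsetSum]
  refine sum_congr rfl fun k _ => ?_
  rw [eval_smul, T_real_cos, smul_eq_mul]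

end Literature.Analysis.Fourier

end
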